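import Mathlib
import HarnessLib
import Summits.QuantumFields.YangMills.Theses.LangevinControlUV
import Literature.Analysis.UnboundedOperators.SpectralGap
import Literature.Probability.LatticeModels.TransferOperator

/-!
# Sketch — crux-ideate, ideator 2, round 1, crux `LatticeGapInUVUnits` (stmt-QuantumFields-9366)

Folder sketch of planner-cruxidea-stmt-QuantumFields-9366-2-0. First-lemma signatures of the two idea cards
`one-ruler` and `femto-slab-nondegeneracy`, plus the typed refutation shape of the crux AS TYPED.

* §0 anatomy — `BoxBounds`, `PackageWith`, `Package`, `Concl` are VERBATIM copies of Disproof.lean v2 §0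
  (cdisprove gen 1; the crux-dir module is not importable on the farm); `crux_iff` re-proved the same way.
  New: `PackageMonoWith`/`PackageMono` (the `MonotoneOn Γ (Ioc 0 ℓ₀)` repair of 9363-ideator-1),
  `CruxMono` (the crux after that repair) and `CruxCont` (Disproof's C′, `Continuous a`); both are WEAKER than
  the crux as typed (`cruxMono_of_crux`, `cruxCont_of_crux`).
* §1 RULER RIGIDITY (card `one-ruler`, first lemma, PROVED sorry-free): two unit maps carrying MONOTONE femto
  packages agree up to constants eventually (`ruler_dominates`, `rulerRigidity`). The only analytic input is the
  vanishing of the shape function along the ruler, `Γ(a(β)) → 0`, which is Disproof §6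
  `packageWith_shape_tendsto_zero` (PROVED there for EVERY package, by fixed-torus concentration) — taken here
  as a hypothesis because Disproof.lean cannot be imported.
* §2 SLAB (card `femto-slab-nondegeneracy`, first lemma, signature only): a quadratic-form bound on the
  SUBSAMPLED transfer operator `T^D` on `Ω^⊥` gives `T.HasTransferGap Ω (1/(2KD))` — rate sharp in `D`.
* §3 REFUTATION SHAPE of the crux as typed (bookkeeping statement; inputs = card generic-step-gamma-encoding@9363
  + XiCompleteMonotonicity items; see crux NOTES.md): `not_crux_of_slow_ruler`.
-/

namespace Summit.QuantumFields.YangMills.Cruxes.LatticeGapInUVUnits.Ideator2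

open Filter Topology MeasureTheory
open scoped InnerProductSpace
open Literature.MathematicalPhysics.QuantumFieldTheory
open Summit.QuantumFields.YangMills.Theses.LangevinControlUV

noncomputable section

/-! ## §0 Anatomy (verbatim from Disproof.lean v2 §0) and the two repairs -/

section Anatomy

variable {G : Type} [Group G] [TopologicalSpace G] [IsTopologicalGroup G] [CompactSpace G]
  [MeasurableSpace G] [BorelSpace G]

/-- Femto two-point bounds in one box (verbatim Disproof §0 `BoxBounds`). -/
def BoxBounds (r : LatticeRep G) (a Γ : ℝ → ℝ) (c C : ℝ) (L : ℕ) [NeZero L] (β : ℝ) : Prop :=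
  let P : (Fin 4 → ZMod L) → Fin 4 → Fin 4 → GaugeConfig 4 L G → ℝ :=
    fun x i j U => (r.N : ℝ) - (r.ρ (plaquetteHolonomy U x i j)).trace.re
  let E : (GaugeConfig 4 L G → ℝ) → ℝ := fun F => wilsonExpectation (d := 4) (L := L) r.ρ β F
  let cov : (GaugeConfig 4 L G → ℝ) → (GaugeConfig 4 L G → ℝ) → ℝ :=
    fun F F' => E (fun U => F U * F' U) - E F * E F'
  let dist : (Fin 4 → ZMod L) → (Fin 4 → ZMod L) → ℝ :=
    fun x y => Real.sqrt (∑ k : Fin 4, (((x k - y k).valMinAbs : ℤ) : ℝ) ^ 2)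
  (∀ n : ℕ, 1 ≤ n → 8 * n ≤ L →
      c * Γ ((n : ℝ) * a β) ≤ (n : ℝ) ^ 8 * cov (P 0 0 1) (P (Pi.single (2 : Fin 4) ((n : ℕ) : ZMod L)) 0 1) ∧
        (n : ℝ) ^ 8 * cov (P 0 0 1) (P (Pi.single (2 : Fin 4) ((n : ℕ) : ZMod L)) 0 1) ≤ C * Γ ((n : ℝ) * a β)) ∧
    (∀ (x y : Fin 4 → ZMod L) (i j i' j' : Fin 4), x ≠ y → i ≠ j → i' ≠ j' →
      |cov (P x i j) (P y i' j')| * dist x y ^ 8 ≤ C * Γ (dist x y * a β))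

/-- The femto package with explicit witnesses (verbatim Disproof §0 `PackageWith`). -/
def PackageWith (r : LatticeRep G) (a Γ : ℝ → ℝ) (β₀ ℓ₀ c C : ℝ) : Prop :=
  0 < ℓ₀ ∧ 0 < c ∧ (∀ β, 0 < a β) ∧ Tendsto a atTop (𝓝 0) ∧
    (∀ s : ℝ, 0 < s → s ≤ ℓ₀ → 0 < Γ s ∧ Γ s ≤ 1) ∧
      ∀ (L : ℕ) [NeZero L] (β : ℝ), β₀ ≤ β → (L : ℝ) * a β ≤ ℓ₀ → BoxBounds r a Γ c C L β

/-- The crux's hypothesis on the unit map (verbatim Disproof §0 `Package`). -/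
def Package (r : LatticeRep G) (a : ℝ → ℝ) : Prop :=
  ∃ (Γ : ℝ → ℝ) (β₀ ℓ₀ c C : ℝ), PackageWith r a Γ β₀ ℓ₀ c C

/-- The crux's conclusion (verbatim Disproof §0 `Concl`). -/
def Concl (r : LatticeRep G) (a : ℝ → ℝ) : Prop :=
  ∃ (c₁ β₂ : ℝ) (S₁ : ℝ → ℕ), 0 < c₁ ∧ ∀ A B : YMSpecies G, ∃ C : ℝ, ∀ β : ℝ, β₂ ≤ β → ∀ S n : ℕ,
    S₁ β ≤ S → n ≤ S → |latticeConnectedCorr r.ρ β (2 * S + 1) A.F B.F n| ≤ C * Real.exp (-(c₁ * a β * n))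

/-- REPAIRED package (9363-ideator-1's one-token repair): the shape function is monotone on `(0, ℓ₀]`
(physically `Γ(s) ≍ ḡ⁴(s)` grows with the distance `s`). -/
def PackageMonoWith (r : LatticeRep G) (a Γ : ℝ → ℝ) (β₀ ℓ₀ c C : ℝ) : Prop :=
  MonotoneOn Γ (Set.Ioc 0 ℓ₀) ∧ PackageWith r a Γ β₀ ℓ₀ c C

/-- Existential form of the repaired package. -/
def PackageMono (r : LatticeRep G) (a : ℝ → ℝ) : Prop :=
  ∃ (Γ : ℝ → ℝ) (β₀ ℓ₀ c C : ℝ), PackageMonoWith r a Γ β₀ ℓ₀ c C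

theorem package_of_packageMono (r : LatticeRep G) {a : ℝ → ℝ} (h : PackageMono r a) : Package r a := by
  obtain ⟨Γ, β₀, ℓ₀, c, C, -, hP⟩ := h
  exact ⟨Γ, β₀, ℓ₀, c, C, hP⟩

end Anatomy

/-- The crux uncurried (as in Disproof §0 `crux_iff`). -/
theorem crux_iff :
    LatticeGapInUVUnits ↔
      ∀ (G : Type) [Group G] [TopologicalSpace G] [IsTopologicalGroup G] [CompactSpace G],
        IsCompactSimpleLieGroup G →
          letI : MeasurableSpace G := borel G
          haveI : BorelSpace G := ⟨rfl⟩
          ∀ (r : LatticeRep G) (a : ℝ → ℝ), Package r a → Concl r a := by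
  constructor
  · intro h G _ _ _ _ hG r a hP
    obtain ⟨Γ, β₀, ℓ₀, c, C, hℓ, hc, hpos, hlim, hΓ, hbox⟩ := hP
    exact h G hG r a ⟨Γ, β₀, ℓ₀, c, C, hℓ, hc, hpos, hlim, hΓ, fun L _ β h₁ h₂ => hbox L β h₁ h₂⟩
  · intro h G _ _ _ _ hG r a hP
    obtain ⟨Γ, β₀, ℓ₀, c, C, hℓ, hc, hpos, hlim, hΓ, hbox⟩ := hP
    exact h G hG r a ⟨Γ, β₀, ℓ₀, c, C, hℓ, hc, hpos, hlim, hΓ, fun L _ β h₁ h₂ => hbox L β h₁ h₂⟩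

/-- The crux after the `MonotoneOn Γ` repair (for discussion only — the route owner decides). -/
def CruxMono : Prop :=
  ∀ (G : Type) [Group G] [TopologicalSpace G] [IsTopologicalGroup G] [CompactSpace G],
    IsCompactSimpleLieGroup G →
      letI : MeasurableSpace G := borel G
      haveI : BorelSpace G := ⟨rfl⟩
      ∀ (r : LatticeRep G) (a : ℝ → ℝ), PackageMono r a → Concl r a

/-- The crux after Disproof's repair C′ (`Continuous a`; for discussion only). -/
def CruxCont : Prop :=
  ∀ (G : Type) [Group G] [TopologicalSpace G] [IsTopologicalGroup G] [CompactSpace G],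
    IsCompactSimpleLieGroup G →
      letI : MeasurableSpace G := borel G
      haveI : BorelSpace G := ⟨rfl⟩
      ∀ (r : LatticeRep G) (a : ℝ → ℝ), Continuous a → Package r a → Concl r a

/-- As typed, the crux is STRONGER than its monotone repair. -/
theorem cruxMono_of_crux (h : LatticeGapInUVUnits) : CruxMono := by
  intro G _ _ _ _ hG
  letI : MeasurableSpace G := borel G
  haveI : BorelSpace G := ⟨rfl⟩
  intro r a hP
  exact crux_iff.1 h G hG r a (package_of_packageMono r hP)

/-- As typed, the crux is STRONGER than Disproof's repair C′. -/
theorem cruxCont_of_crux (h : LatticeGapInUVUnits) : CruxCont := by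
  intro G _ _ _ _ hG r a _ hP
  exact crux_iff.1 h G hG r a hP

/-! ## §1 Ruler rigidity (card `one-ruler`): monotone femto rulers agree up to constants -/

section Rigidity

variable {G : Type} [Group G] [TopologicalSpace G] [IsTopologicalGroup G] [CompactSpace G]
  [MeasurableSpace G] [BorelSpace G]

/-- **One-sided ruler domination.** If `a₁, a₂` both carry femto packages with MONOTONE shape functions, and the
shape of ruler 1 vanishes along ruler 1 (`Γ₁ (a₁ β) → 0`, which Disproof §6 `packageWith_shape_tendsto_zero`
proves for every package), then `a₂ ≤ K · a₁` eventually. Proof: in the largest femto box of ruler 2 at coupling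
`β` (`L = ⌊ℓ₀'/a₂ β⌋`, `n = L/8`) the ruler-2 LOWER bound pins `n⁸·Cov ≥ c'·Γ₂(ℓ₀'/16) =: η > 0` (monotonicity);
if that box is femto for ruler 1 its UPPER bound gives `Γ₁(n·a₁ β) ≥ η / max C 1`, so by monotonicity
`n·a₁ β` exceeds a FIXED level `α = a₁ β₄` where `Γ₁` is already below `η / max C 1`; either way
`a₂ β ≤ max(ℓ₀'/ℓ₀, ℓ₀'/(8α)) · a₁ β`. Pure order bookkeeping over the package; no physics. -/
theorem ruler_dominates (r : LatticeRep G) {a₁ a₂ Γ₁ Γ₂ : ℝ → ℝ} {β₀ ℓ₀ c C β₀' ℓ₀' c' C' : ℝ}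
    (h₁ : PackageWith r a₁ Γ₁ β₀ ℓ₀ c C) (h₂ : PackageWith r a₂ Γ₂ β₀' ℓ₀' c' C')
    (hm₁ : MonotoneOn Γ₁ (Set.Ioc 0 ℓ₀)) (hm₂ : MonotoneOn Γ₂ (Set.Ioc 0 ℓ₀'))
    (hv₁ : Tendsto (fun β => Γ₁ (a₁ β)) atTop (𝓝 0)) :
    ∃ K β₃ : ℝ, 0 < K ∧ ∀ β, β₃ ≤ β → a₂ β ≤ K * a₁ β := by
  obtain ⟨hℓ, hc, hpos₁, hlim₁, hΓ₁, hbox₁⟩ := h₁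
  obtain ⟨hℓ', hc', hpos₂, hlim₂, hΓ₂, hbox₂⟩ := h₂
  -- the level of ruler 2 at the femto edge and the resulting covariance floor `η`
  set γ : ℝ := Γ₂ (ℓ₀' / 16) with hγdef
  have hγ : 0 < γ := (hΓ₂ _ (by positivity) (by linarith)).1
  set η : ℝ := c' * γ with hηdef
  have hη : 0 < η := mul_pos hc' hγ
  set Cb : ℝ := max C 1 with hCbdef
  have hCb : 0 < Cb := lt_of_lt_of_le one_pos (le_max_right C 1)
  set θ : ℝ := η / Cb with hθdef
  have hθ : 0 < θ := div_pos hη hCb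
  -- a fixed coupling `β₄` where the shape of ruler 1 is already below `θ`
  have hev₁ : ∀ᶠ β' in atTop, Γ₁ (a₁ β') < θ ∧ a₁ β' ≤ ℓ₀ :=
    ((tendsto_order.1 hv₁).2 θ hθ).and (hlim₁ (Iic_mem_nhds hℓ))
  obtain ⟨β₄, hβ₄lt, hβ₄le⟩ := hev₁.exists
  set α : ℝ := a₁ β₄ with hαdef
  have hα : 0 < α := hpos₁ β₄
  -- threshold `β₃`
  have hev₂ : ∀ᶠ β in atTop, a₂ β ≤ ℓ₀' / 18 := hlim₂ (Iic_mem_nhds (by positivity))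
  obtain ⟨β₅, hβ₅⟩ := Filter.eventually_atTop.1
    (hev₂.and ((eventually_ge_atTop β₀).and (eventually_ge_atTop β₀')))
  refine ⟨max (ℓ₀' / ℓ₀) (ℓ₀' / (8 * α)), β₅, lt_max_of_lt_left (div_pos hℓ' hℓ), fun β hβ => ?_⟩
  obtain ⟨ha₂, hb₀, hb₀'⟩ := hβ₅ β hβ
  have ha₁pos : 0 < a₁ β := hpos₁ β
  have ha₂pos : 0 < a₂ β := hpos₂ β
  have hK₁ : ℓ₀' / ℓ₀ ≤ max (ℓ₀' / ℓ₀) (ℓ₀' / (8 * α)) := le_max_left _ _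
  have hK₂ : ℓ₀' / (8 * α) ≤ max (ℓ₀' / ℓ₀) (ℓ₀' / (8 * α)) := le_max_right _ _
  -- the largest femto box of ruler 2
  set L : ℕ := ⌊ℓ₀' / a₂ β⌋₊ with hLdef
  have hLle : (L : ℝ) ≤ ℓ₀' / a₂ β := Nat.floor_le (by positivity)
  have hLge : ℓ₀' / a₂ β - 1 < (L : ℝ) := Nat.sub_one_lt_floor _
  have h18 : (18 : ℝ) ≤ ℓ₀' / a₂ β := by
    rw [le_div_iff₀ ha₂pos]
    have := (le_div_iff₀ (by norm_num : (0 : ℝ) < 18)).1 ha₂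
    linarith
  have hL17R : (17 : ℝ) ≤ (L : ℝ) := by linarith
  have hL16 : 16 ≤ L := by exact_mod_cast (show ((16 : ℕ) : ℝ) ≤ (L : ℝ) by push_cast; linarith)
  haveI : NeZero L := ⟨by omega⟩
  set n : ℕ := L / 8 with hndef
  have hn1 : 1 ≤ n := by omega
  have h8n : 8 * n ≤ L := by omega
  have hnlt : L < 8 * n + 8 := by omega
  have hnpos : (0 : ℝ) < n := by exact_mod_cast (show 0 < n by omega)
  have hnR : (8 : ℝ) * n ≤ L := by exact_mod_cast h8n
  have hnR' : (L : ℝ) < 8 * n + 8 := by exact_mod_cast hnlt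
  -- femto for ruler 2, and the ruler-2 lower bound at separation `n`
  have hfem₂ : (L : ℝ) * a₂ β ≤ ℓ₀' := by rwa [← le_div_iff₀ ha₂pos]
  obtain ⟨hax₂, -⟩ := hbox₂ L β hb₀' hfem₂
  have hlow := (hax₂ n hn1 h8n).1
  -- `n · a₂ β ∈ [ℓ₀'/16, ℓ₀'/8]`
  have hA : ℓ₀' - a₂ β ≤ (L : ℝ) * a₂ β := by
    have := mul_le_mul_of_nonneg_right hLge.le ha₂pos.le
    rwa [sub_mul, div_mul_cancel₀ ℓ₀' ha₂pos.ne', one_mul] at this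
  have hB : (L : ℝ) * a₂ β < 8 * ((n : ℝ) * a₂ β) + 8 * a₂ β := by
    have := mul_lt_mul_of_pos_right hnR' ha₂pos
    have e : (8 * (n : ℝ) + 8) * a₂ β = 8 * ((n : ℝ) * a₂ β) + 8 * a₂ β := by ring
    linarith [e]
  have hC₈ : 8 * ((n : ℝ) * a₂ β) ≤ (L : ℝ) * a₂ β := by
    have := mul_le_mul_of_nonneg_right hnR ha₂pos.le
    have e : (8 : ℝ) * n * a₂ β = 8 * ((n : ℝ) * a₂ β) := by ring
    linarith [e]
  have hs₂lo : ℓ₀' / 16 ≤ (n : ℝ) * a₂ β := by linarith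
  have hs₂hi : (n : ℝ) * a₂ β ≤ ℓ₀' / 8 := by linarith
  have hs₂pos : 0 < (n : ℝ) * a₂ β := mul_pos hnpos ha₂pos
  have hΓ₂ge : γ ≤ Γ₂ ((n : ℝ) * a₂ β) :=
    hm₂ ⟨by positivity, by linarith⟩ ⟨hs₂pos, by linarith⟩ hs₂lo
  have hηle : η ≤ c' * Γ₂ ((n : ℝ) * a₂ β) := mul_le_mul_of_nonneg_left hΓ₂ge hc'.le
  -- case split: is the box femto for ruler 1?
  by_cases hfem₁ : (L : ℝ) * a₁ β ≤ ℓ₀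
  · -- Case B: both rulers see the box; compare the two-sided bounds at separation `n`
    obtain ⟨hax₁, -⟩ := hbox₁ L β hb₀ hfem₁
    have hup := (hax₁ n hn1 h8n).2
    have key : c' * Γ₂ ((n : ℝ) * a₂ β) ≤ C * Γ₁ ((n : ℝ) * a₁ β) := hlow.trans hup
    have hxpos : 0 < (n : ℝ) * a₁ β := mul_pos hnpos ha₁pos
    have hx₈ : 8 * ((n : ℝ) * a₁ β) ≤ (L : ℝ) * a₁ β := by
      have := mul_le_mul_of_nonneg_right hnR ha₁pos.le
      have e : (8 : ℝ) * n * a₁ β = 8 * ((n : ℝ) * a₁ β) := by ring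
      linarith [e]
    have hxle : (n : ℝ) * a₁ β ≤ ℓ₀ := by linarith
    have hΓ₁x : 0 < Γ₁ ((n : ℝ) * a₁ β) := (hΓ₁ _ hxpos hxle).1
    have hCx : C * Γ₁ ((n : ℝ) * a₁ β) ≤ Cb * Γ₁ ((n : ℝ) * a₁ β) :=
      mul_le_mul_of_nonneg_right (le_max_left C 1) hΓ₁x.le
    have hθx : θ ≤ Γ₁ ((n : ℝ) * a₁ β) := by
      rw [hθdef, div_le_iff₀ hCb]
      nlinarith [hηle, key, hCx]
    -- monotonicity forces `n · a₁ β` above the fixed level `α`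
    have hna : α < (n : ℝ) * a₁ β := by
      by_contra hle
      push Not at hle
      have hmon : Γ₁ ((n : ℝ) * a₁ β) ≤ Γ₁ α := hm₁ ⟨hxpos, hxle⟩ ⟨hα, hβ₄le⟩ hle
      linarith
    -- hence `a₂ β ≤ ℓ₀'/(8α) · a₁ β`
    have hfin : a₂ β * (8 * α) ≤ ℓ₀' * a₁ β := by
      have h1 : a₂ β * (8 * α) ≤ a₂ β * (8 * ((n : ℝ) * a₁ β)) := by
        have : 8 * α ≤ 8 * ((n : ℝ) * a₁ β) := by linarith
        exact mul_le_mul_of_nonneg_left this ha₂pos.le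
      have h2 : a₂ β * (8 * ((n : ℝ) * a₁ β)) = 8 * ((n : ℝ) * a₂ β) * a₁ β := by ring
      have h3 : 8 * ((n : ℝ) * a₂ β) * a₁ β ≤ 8 * (ℓ₀' / 8) * a₁ β :=
        mul_le_mul_of_nonneg_right (by linarith) ha₁pos.le
      have h4 : 8 * (ℓ₀' / 8) * a₁ β = ℓ₀' * a₁ β := by ring
      linarith [h1, h2, h3, h4]
    have hdom : a₂ β ≤ ℓ₀' / (8 * α) * a₁ β := by
      rw [div_mul_eq_mul_div, le_div_iff₀ (by positivity)]
      linarith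
    exact hdom.trans (mul_le_mul_of_nonneg_right hK₂ ha₁pos.le)
  · -- Case A: the box is NOT femto for ruler 1, i.e. `ℓ₀ < L · a₁ β`; then `a₂ β < (ℓ₀'/ℓ₀) · a₁ β`
    push Not at hfem₁
    have h1 : a₂ β * ℓ₀ < a₂ β * ((L : ℝ) * a₁ β) := mul_lt_mul_of_pos_left hfem₁ ha₂pos
    have h2 : a₂ β * ((L : ℝ) * a₁ β) = ((L : ℝ) * a₂ β) * a₁ β := by ring
    have h3 : ((L : ℝ) * a₂ β) * a₁ β ≤ ℓ₀' * a₁ β := mul_le_mul_of_nonneg_right hfem₂ ha₁pos.le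
    have hdom : a₂ β ≤ ℓ₀' / ℓ₀ * a₁ β := by
      rw [div_mul_eq_mul_div, le_div_iff₀ hℓ]
      linarith
    exact hdom.trans (mul_le_mul_of_nonneg_right hK₁ ha₁pos.le)

/-- **Ruler rigidity** (two-sided corollary): any two monotone femto rulers are equivalent up to constants,
eventually in `β`. With Disproof §6 the two vanishing hypotheses are theorems, so under the `MonotoneOn Γ` repair
the socket `LatticeGapInUVUnits` is CANONICAL: its rate `c₁ · a(β)` may be certified in ANY monotone femto ruler. -/
theorem rulerRigidity (r : LatticeRep G) {a₁ a₂ Γ₁ Γ₂ : ℝ → ℝ} {β₀ ℓ₀ c C β₀' ℓ₀' c' C' : ℝ}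
    (h₁ : PackageMonoWith r a₁ Γ₁ β₀ ℓ₀ c C) (h₂ : PackageMonoWith r a₂ Γ₂ β₀' ℓ₀' c' C')
    (hv₁ : Tendsto (fun β => Γ₁ (a₁ β)) atTop (𝓝 0)) (hv₂ : Tendsto (fun β => Γ₂ (a₂ β)) atTop (𝓝 0)) :
    ∃ K β₃ : ℝ, 0 < K ∧ ∀ β, β₃ ≤ β → a₂ β ≤ K * a₁ β ∧ a₁ β ≤ K * a₂ β := by
  obtain ⟨K₁, β₁, hK₁, hd₁⟩ := ruler_dominates r h₁.2 h₂.2 h₁.1 h₂.1 hv₁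
  obtain ⟨K₂, β₂, hK₂, hd₂⟩ := ruler_dominates r h₂.2 h₁.2 h₂.1 h₁.1 hv₂
  refine ⟨max K₁ K₂, max β₁ β₂, lt_max_of_lt_left hK₁, fun β hβ => ⟨?_, ?_⟩⟩
  · exact (hd₁ β (le_of_max_le_left hβ)).trans
      (mul_le_mul_of_nonneg_right (le_max_left _ _) (h₁.2.2.2.1 β).le)
  · exact (hd₂ β (le_of_max_le_right hβ)).trans
      (mul_le_mul_of_nonneg_right (le_max_right _ _) (h₂.2.2.2.1 β).le)

/-- Under rigidity the conclusion transfers between monotone rulers (with Disproof §1 `concl_of_eventually_le`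
this is immediate; re-proved here in the form the socket needs): clustering at rate `c₁ · a₁` implies clustering
at rate `(c₁/K) · a₂` once `a₂ ≤ K a₁` eventually. -/
theorem concl_transfer (r : LatticeRep G) {a₁ a₂ : ℝ → ℝ} {K β₃ : ℝ} (hK : 0 < K)
    (hdom : ∀ β, β₃ ≤ β → a₂ β ≤ K * a₁ β) (h : Concl r a₁) : Concl r a₂ := by
  obtain ⟨c₁, β₂, S₁, hc₁, hAB⟩ := h
  refine ⟨c₁ / K, max β₂ β₃, S₁, div_pos hc₁ hK, fun A B => ?_⟩
  obtain ⟨C₀, hC₀⟩ := hAB A B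
  refine ⟨C₀, fun β hβ S n hS hn => ?_⟩
  have hb := hC₀ β (le_of_max_le_left hβ) S n hS hn
  refine hb.trans ?_
  have hCnn : 0 ≤ C₀ := by
    -- `C₀ ≥ 0` because it dominates an absolute value times a positive exponential
    have hexp : 0 < Real.exp (-(c₁ * a₁ β * n)) := Real.exp_pos _
    have h0 : 0 ≤ C₀ * Real.exp (-(c₁ * a₁ β * n)) := (abs_nonneg _).trans hb
    by_contra hneg
    push Not at hneg
    have := mul_neg_of_neg_of_pos hneg hexp
    linarith
  apply mul_le_mul_of_nonneg_left _ hCnn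
  apply Real.exp_le_exp.2
  have hd := hdom β (le_of_max_le_right hβ)
  have hn0 : (0 : ℝ) ≤ n := by exact_mod_cast Nat.zero_le n
  have : c₁ / K * a₂ β * n ≤ c₁ * a₁ β * n := by
    have h1 : c₁ / K * a₂ β ≤ c₁ / K * (K * a₁ β) := mul_le_mul_of_nonneg_left hd (div_pos hc₁ hK).le
    have h2 : c₁ / K * (K * a₁ β) = c₁ * a₁ β := by field_simp
    exact mul_le_mul_of_nonneg_right (by linarith) hn0
  linarith

end Rigidity

/-! ## §2 Slab (card `femto-slab-nondegeneracy`): subsampled form bound ⇒ transfer gap, rate sharp in `D` -/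

section Slab

variable {E : Type*} [NormedAddCommGroup E] [InnerProductSpace ℂ E] [CompleteSpace E]

/-- **Subsampled quadratic-form bound ⇒ transfer gap.** For a positive contraction `T` fixing `Ω`, if the
`D`-fold subsampled operator satisfies `re ⟪T^D x, x⟫ ≤ (1 − 1/(2K)) ‖x‖²` on `Ω^⊥` (this is what the slab
inequality `Var f ≤ K · E Var(f ∘ shift^D | slices 0, 2D)` delivers on the dense time-zero vectors, by the law
of total variance and `½ E(f_D − f_0)² = ⟪v, (1 − T^D) v⟫`), then `T.HasTransferGap Ω (1/(2KD))`:
spectral Jensen `⟪T x, x⟫^D ≤ ⟪T^D x, x⟫ ‖x‖^{2(D−1)}` and `(1 − u)^{1/D} ≤ e^{−u/D}`. Signature only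
(M-sized; continuous functional calculus). -/
theorem hasTransferGap_of_pow_form_bound (T : E →L[ℂ] E) (Ω : E) (hT : T.IsPositive) (hT₁ : ‖T‖ ≤ 1)
    (hΩ : Ω ≠ 0) (hTΩ : T Ω = Ω) {D : ℕ} (hD : 0 < D) {K : ℝ} (hK : 1 / 2 < K)
    (h : ∀ x ∈ (ℂ ∙ Ω)ᗮ, RCLike.re (⟪(T ^ D) x, x⟫_ℂ) ≤ (1 - 1 / (2 * K)) * ‖x‖ ^ 2) :
    T.HasTransferGap Ω (1 / (2 * K * D)) := by
  sorry

end Slab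

/-! ## §3 Refutation shape of the crux AS TYPED (bookkeeping; the three inputs are existing items) -/

section Refutation

variable {G : Type} [Group G] [TopologicalSpace G] [IsTopologicalGroup G] [CompactSpace G]
  [MeasurableSpace G] [BorelSpace G]

/-- A quantitative LOWER bound on SOME pair's torus correlations at rate `m(β)` per lattice step, in the shape
dual to `Concl`: for all large `β` there is an amplitude `A > 0` such that on tori of unbounded size the
correlation at the half-diameter `n = S` is at least `A e^{−m(β) S}` (supplied, after passage to infinite-volume
limit points, by `XiCompleteMonotonicity.XiExpLowerBound` / `PolynomialWindow` + `AxialLogConvexity`). -/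
def LowerBoundAtRate (r : LatticeRep G) (m : ℝ → ℝ) : Prop :=
  ∃ (A B : YMSpecies G) (β₆ : ℝ), ∀ β : ℝ, β₆ ≤ β → ∃ Amp : ℝ, 0 < Amp ∧ ∀ S₀ : ℕ, ∃ S : ℕ, S₀ ≤ S ∧
    Amp * Real.exp (-(m β * S)) ≤ |latticeConnectedCorr r.ρ β (2 * S + 1) A.F B.F S|

end Refutation

/-- **The crux as typed is refuted by a slow ruler** (shape): if for ONE compact simple `G` and faithful `r`
some unit map `a` carries the femto package (e.g. the generic step ruler of card generic-step-gamma-encoding@9363,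
fed by `FixedTorusSemiclassicalTwoPoint`) while some pair's correlations obey a lower bound at a rate
`m(β) = o(a(β))` (e.g. `m = K β e^{−cβ}` from `XiExpLowerBound`, any sub-exponential `a`), then
`¬ LatticeGapInUVUnits`. Bookkeeping (`A e^{−mS} ≤ C e^{−c₁ a S}` for unboundedly many `S` forces `m ≥ c₁ a`);
PROVED sorry-free below (pure bookkeeping; the three inputs are the open part). -/
theorem not_crux_of_slow_ruler
    (hex : ∃ (G : Type) (_ : Group G) (_ : TopologicalSpace G) (_ : IsTopologicalGroup G) (_ : CompactSpace G),
      IsCompactSimpleLieGroup G ∧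
        letI : MeasurableSpace G := borel G
        haveI : BorelSpace G := ⟨rfl⟩
        ∃ (r : LatticeRep G) (a m : ℝ → ℝ), Package r a ∧ LowerBoundAtRate r m ∧
          Tendsto (fun β => m β / a β) atTop (𝓝 0)) :
    ¬ LatticeGapInUVUnits := by
  intro hcrux
  obtain ⟨G, iG, iT, iTG, iC, hG, hrest⟩ := hex
  letI : MeasurableSpace G := borel G
  haveI : BorelSpace G := ⟨rfl⟩
  obtain ⟨r, a, m, hP, hLB, hlim⟩ := hrest
  have hC : Concl r a := crux_iff.1 hcrux G hG r a hP
  obtain ⟨c₁, β₂, S₁, hc₁, hAB⟩ := hC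
  obtain ⟨A, B, β₆, hβ⟩ := hLB
  obtain ⟨C₀, hC₀⟩ := hAB A B
  obtain ⟨Γ, β₀, ℓ₀, c, Cc, -, -, hpos, -, -, -⟩ := hP
  -- a coupling where the lower-bound rate is already below the crux's rate
  have hev : ∀ᶠ β in atTop, m β / a β < c₁ := (tendsto_order.1 hlim).2 c₁ hc₁
  obtain ⟨β, hβge, hmlt⟩ := ((eventually_ge_atTop (max β₂ β₆)).and hev).exists
  have hma : m β < c₁ * a β := by rwa [div_lt_iff₀ (hpos β)] at hmlt
  have hδ : 0 < c₁ * a β - m β := by linarith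
  obtain ⟨Amp, hAmp, hS⟩ := hβ β (le_of_max_le_right hβge)
  -- the upper bound's excess decay beats any fixed amplitude for large `S`
  have h1 : Tendsto (fun S : ℕ => (c₁ * a β - m β) * (S : ℝ)) atTop atTop :=
    Tendsto.const_mul_atTop hδ tendsto_natCast_atTop_atTop
  have h2 : Tendsto (fun S : ℕ => Real.exp (-((c₁ * a β - m β) * (S : ℝ)))) atTop (𝓝 0) :=
    Real.tendsto_exp_neg_atTop_nhds_zero.comp h1
  have h3 := h2.const_mul C₀
  rw [mul_zero] at h3
  have hev2 : ∀ᶠ S : ℕ in atTop, C₀ * Real.exp (-((c₁ * a β - m β) * (S : ℝ))) < Amp :=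
    (tendsto_order.1 h3).2 Amp hAmp
  obtain ⟨S₀, hS₀⟩ := Filter.eventually_atTop.1 (hev2.and (eventually_ge_atTop (S₁ β)))
  obtain ⟨S, hSge, hlowS⟩ := hS S₀
  obtain ⟨hsmall, hS₁⟩ := hS₀ S hSge
  have hup := hC₀ β (le_of_max_le_left hβge) S S hS₁ le_rfl
  have hchain : Amp * Real.exp (-(m β * S)) ≤ C₀ * Real.exp (-(c₁ * a β * S)) := hlowS.trans hup
  have hsplit : Real.exp (-(c₁ * a β * S)) =
      Real.exp (-((c₁ * a β - m β) * (S : ℝ))) * Real.exp (-(m β * S)) := by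
    rw [← Real.exp_add]
    congr 1
    ring
  rw [hsplit, ← mul_assoc] at hchain
  have hAmp_le : Amp ≤ C₀ * Real.exp (-((c₁ * a β - m β) * (S : ℝ))) :=
    le_of_mul_le_mul_right hchain (Real.exp_pos _)
  linarith

end

end Summit.QuantumFields.YangMills.Cruxes.LatticeGapInUVUnits.Ideator2
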